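import Summits.HubbardSuperconductivity.HubbardSuperconductivity.Theorems.AnisotropyChordTransferFibre3KT1Targets
import Summits.HubbardSuperconductivity.HubbardSuperconductivity.Theorems.AnisotropyChordTransferFibre3C0Layer

/-!
# Route `AnisotropyChord` / H0 rotor rung: PartN33 Layer D — `C0FreeBound` (route R1 of the N-term) PROVED

PartN33 = `…Fibre3KT1Targets` (theory seat `hubbard-h0-rotor-theory-1`, memo 21 §307(b)): the `W = 0` part of `‖C0‖²`
is bounded by the named one-loop quantity `Ψ = Σ_{e,e'} ψ_{e,e'}²`:
**`c0FreeBound_holds (Δ) : C0FreeBound L Δ`** — `‖C0‖²_{W=0} ≤ (9/4)·M²·Ψ` for `|f| ≤ M`, every `L`, every `Δ`.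

Proof (finite lattice sums over the tree definitions; the two-magnon input enters only through `C0Explicit`):
* on a `W = 0` configuration off the hard core the three points `a, b, b − a` are regular (neither `0` nor a neighbour),
  so `D_e f = −D_e s` there, and `D_{−e} f(a) = D_e f(−a)` for even `f`; `C0Explicit` (`c0Explicit_holds`, `…C0Layer`)
  then reads `C0(a,b) = −½ (f(b−a)·T(a,b) + f(b)·T(−a,b−a) + f(a)·T(b,b−a))`, `T(u,v) := Σ_e D_e s(u) D_e s(v)`;
* `(x+y+z)² ≤ 3(x²+y²+z²)` and `f² ≤ M²` give `C0(a,b)² ≤ ¾ M² (T(a,b)² + T(−a,b−a)² + T(b,b−a)²)`;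
* the three maps `(a,b) ↦ (a,b), (−a,b−a), (b,b−a)` send the `W = 0` configurations injectively into pairs of regular
  points, so each of the three sums is `≤ Σ_{u,v regular} T(u,v)²`;
* `Σ_{u,v regular} T(u,v)² = Σ_{e,e'} (Σ_{u regular} D_e s(u) D_{e'} s(u))² = Ψ` (`sum_sum_sq_sum_mul`, exchange of finite sums).

No hypothesis on `L` or `Δ` is needed.  Nothing here proves superconductivity in the Hubbard model; these are helper
lemmas of ONE conditional reduction (rung stmt-HubbardSuperconductivity-19089).
Prover seat `hubbard-h0-rotor-p3` g0; `--supports stmt-HubbardSuperconductivity-19089`.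
-/

set_option linter.dupNamespace false
set_option autoImplicit false

noncomputable section

open scoped BigOperators
open Complex

namespace Summit.HubbardSuperconductivity.HubbardSuperconductivity.Theorems.AnisotropyChord.Transfer.Fibre3

variable (L : ℕ) [NeZero L]

/-! ## Bookkeeping: `nnList` sums as `Fin 4` sums, `W = 0`, the exchange identity -/

omit [NeZero L] in
/-- a `nnList` sum as a sum over `Fin 4` with the vector `(eₓ, −eₓ, e_y, −e_y)`. [folklore] -/
theorem nnList_sum_fin4 (h : Tor L → ℝ) :
    ((nnList L).map h).sum = ∑ i : Fin 4, h (![ex L, -ex L, ey L, -ey L] i) := by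
  rw [nnList_map_sum, Fin.sum_univ_four]
  simp

omit [NeZero L] in
/-- the four entries of `(eₓ, −eₓ, e_y, −e_y)` are nearest-neighbour vectors. [folklore] -/
theorem isNN_fin4 (i : Fin 4) : IsNN L (![ex L, -ex L, ey L, -ey L] i) = true := by
  fin_cases i <;> simp [IsNN_neg, isNN_ex, isNN_ey]

omit [NeZero L] in
/-- `W(c) = 0`: none of `a, b, b − a` is a nearest-neighbour vector. [folklore] -/
theorem isNN_of_Wcount_zero (c : Cfg L) (h : Wcount L c = 0) :
    IsNN L c.1 = false ∧ IsNN L c.2 = false ∧ IsNN L (c.2 - c.1) = false := by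
  unfold Wcount at h
  cases h1 : IsNN L c.1 <;> cases h2 : IsNN L c.2 <;> cases h3 : IsNN L (c.2 - c.1) <;> simp [h1, h2, h3] at h ⊢

/-- **exchange identity:** `Σ_{u,v ∈ S} (Σ_i x_i(u) x_i(v))² = Σ_{i,j} (Σ_{u ∈ S} x_i(u) x_j(u))²`. [folklore] -/
theorem sum_sum_sq_sum_mul {ι α : Type*} [Fintype ι] (S : Finset α) (x : ι → α → ℝ) :
    ∑ u ∈ S, ∑ v ∈ S, (∑ i, x i u * x i v) ^ 2 = ∑ i, ∑ j, (∑ u ∈ S, x i u * x j u) ^ 2 := by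
  have lhs : ∀ u v : α, (∑ i, x i u * x i v) ^ 2 = ∑ i, ∑ j, (x i u * x j u) * (x i v * x j v) := by
    intro u v
    rw [sq, Finset.sum_mul_sum]
    exact Finset.sum_congr rfl fun i _ => Finset.sum_congr rfl fun j _ => by ring
  have rhs : ∀ i j : ι, (∑ u ∈ S, x i u * x j u) ^ 2 = ∑ u ∈ S, ∑ v ∈ S, (x i u * x j u) * (x i v * x j v) := by
    intro i j
    rw [sq, Finset.sum_mul_sum]
  simp_rw [lhs, rhs]
  calc ∑ u ∈ S, ∑ v ∈ S, ∑ i, ∑ j, x i u * x j u * (x i v * x j v)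
      = ∑ u ∈ S, ∑ i, ∑ v ∈ S, ∑ j, x i u * x j u * (x i v * x j v) :=
        Finset.sum_congr rfl fun u _ => Finset.sum_comm
    _ = ∑ u ∈ S, ∑ i, ∑ j, ∑ v ∈ S, x i u * x j u * (x i v * x j v) :=
        Finset.sum_congr rfl fun u _ => Finset.sum_congr rfl fun i _ => Finset.sum_comm
    _ = ∑ i, ∑ u ∈ S, ∑ j, ∑ v ∈ S, x i u * x j u * (x i v * x j v) := Finset.sum_comm
    _ = ∑ i, ∑ j, ∑ u ∈ S, ∑ v ∈ S, x i u * x j u * (x i v * x j v) :=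
        Finset.sum_congr rfl fun i _ => Finset.sum_comm

/-! ## The core estimate, for an abstract direction vector and abstract index sets -/

/-- **the particle-split / lag-correlation bound**, stated for a direction vector `d` enumerating `nnList`, a finite set `F`
of configurations with `W = 0` and the finite set `Reg` of regular points. [folklore] -/
theorem c0Free_core {Δ lam2 M : ℝ} {f : Tor L → ℝ} (htm : IsTwoMagnon L Δ lam2 f)
    (heven : ∀ r : Tor L, f (-r) = f r) (hM : ∀ r : Tor L, |f r| ≤ M)
    (d : Fin 4 → Tor L) (hd : ∀ h : Tor L → ℝ, ((nnList L).map h).sum = ∑ i, h (d i))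
    (hdNN : ∀ i : Fin 4, IsNN L (d i) = true)
    (F : Finset (Cfg L)) (hF : ∀ c : Cfg L, c ∈ F → Wcount L c = 0)
    (Reg : Finset (Tor L)) (hReg : ∀ a : Tor L, a ≠ 0 → IsNN L a = false → a ∈ Reg) :
    ∑ c ∈ F, C0fn L Δ lam2 f c ^ 2
      ≤ 9 / 4 * M ^ 2 *
          ∑ i : Fin 4, ∑ j : Fin 4, (∑ a ∈ Reg, Dgrad L (sfun' L Δ f) (d i) a * Dgrad L (sfun' L Δ f) (d j) a) ^ 2 := by
  classical
  set s : Tor L → ℝ := sfun' L Δ f with hs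
  -- the mixed gradient form `T(u,v) = Σ_i D_i s(u) D_i s(v)`
  obtain ⟨T, hT⟩ : ∃ T : Cfg L → ℝ, ∀ p : Cfg L, T p = ∑ i : Fin 4, Dgrad L s (d i) p.1 * Dgrad L s (d i) p.2 :=
    ⟨fun p => ∑ i : Fin 4, Dgrad L s (d i) p.1 * Dgrad L s (d i) p.2, fun p => rfl⟩
  -- (1) Ψ = Σ_{Reg × Reg} T²
  have hPsi : ∑ i : Fin 4, ∑ j : Fin 4, (∑ a ∈ Reg, Dgrad L s (d i) a * Dgrad L s (d j) a) ^ 2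
      = ∑ p ∈ Reg ×ˢ Reg, T p ^ 2 := by
    rw [Finset.sum_product, ← sum_sum_sq_sum_mul Reg (fun i a => Dgrad L s (d i) a)]
    simp only [hT]
  -- (2) regular points: `D_e f = −D_e s`, and `D_{−e} f(u) = D_e f(−u)` for even `f`
  have hreg : ∀ u : Tor L, u ≠ 0 → IsNN L u = false → ∀ i : Fin 4, Dgrad L f (d i) u = -Dgrad L s (d i) u := by
    intro u hu hun i
    have hue : u - d i ≠ 0 := by
      intro h
      rw [sub_eq_zero] at h
      rw [h, hdNN i] at hun
      exact Bool.noConfusion hun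
    rw [hs]
    unfold Dgrad sfun'
    simp only [if_neg hu, if_neg hue]
    ring
  have hneg_e : ∀ u e : Tor L, Dgrad L f (-e) u = Dgrad L f e (-u) := by
    intro u e
    unfold Dgrad
    rw [sub_neg_eq_add, heven, show -u - e = -(u + e) by abel, heven]
  have hf2 : ∀ r : Tor L, f r ^ 2 ≤ M ^ 2 := by
    intro r
    have h := hM r
    rw [← sq_abs (f r)]
    exact pow_le_pow_left₀ (abs_nonneg _) h 2
  -- (3) the pointwise bound off the hard core
  have hpt : ∀ c ∈ F.filter (fun c => InD L c = false),
      C0fn L Δ lam2 f c ^ 2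
        ≤ 3 / 4 * M ^ 2 * (T (c.1, c.2) ^ 2 + T (-c.1, c.2 - c.1) ^ 2 + T (c.2, c.2 - c.1) ^ 2) := by
    intro c hc
    rw [Finset.mem_filter] at hc
    obtain ⟨hcF, hD⟩ := hc
    obtain ⟨hna, hnb, hnc⟩ := isNN_of_Wcount_zero L c (hF c hcF)
    have hD' := hD
    unfold InD at hD'
    simp only [Bool.or_eq_false_iff, decide_eq_false_iff_not] at hD'
    obtain ⟨⟨ha, hb⟩, hab⟩ := hD'
    have hcc : c.2 - c.1 ≠ 0 := sub_ne_zero.mpr (fun h => hab h.symm)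
    have hna' : IsNN L (-c.1) = false := by rw [IsNN_neg]; exact hna
    have ha' : -c.1 ≠ 0 := neg_ne_zero.mpr ha
    have hC0 : C0fn L Δ lam2 f c
        = -(1 / 2) * (f (c.2 - c.1) * T (c.1, c.2) + f c.2 * T (-c.1, c.2 - c.1) + f c.1 * T (c.2, c.2 - c.1)) := by
      rw [c0Explicit_holds L Δ lam2 f htm c hD, hd]
      congr 1
      rw [hT, hT, hT, Finset.mul_sum, Finset.mul_sum, Finset.mul_sum, ← Finset.sum_add_distrib,
        ← Finset.sum_add_distrib]
      refine Finset.sum_congr rfl fun i _ => ?_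
      rw [hneg_e, hreg c.1 ha hna i, hreg c.2 hb hnb i, hreg (c.2 - c.1) hcc hnc i, hreg (-c.1) ha' hna' i]
      ring
    have hX : (f (c.2 - c.1) * T (c.1, c.2)) ^ 2 ≤ M ^ 2 * T (c.1, c.2) ^ 2 := by
      rw [mul_pow]; exact mul_le_mul_of_nonneg_right (hf2 _) (sq_nonneg _)
    have hY : (f c.2 * T (-c.1, c.2 - c.1)) ^ 2 ≤ M ^ 2 * T (-c.1, c.2 - c.1) ^ 2 := by
      rw [mul_pow]; exact mul_le_mul_of_nonneg_right (hf2 _) (sq_nonneg _)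
    have hZ : (f c.1 * T (c.2, c.2 - c.1)) ^ 2 ≤ M ^ 2 * T (c.2, c.2 - c.1) ^ 2 := by
      rw [mul_pow]; exact mul_le_mul_of_nonneg_right (hf2 _) (sq_nonneg _)
    -- `(x + y + z)² ≤ 3(x² + y² + z²)` (cf. `Literature.NumberTheory.Sieve.MatomakiRadziwillL14.sq_add_three_le`)
    have h3 : ∀ x y z : ℝ, (x + y + z) ^ 2 ≤ 3 * (x ^ 2 + y ^ 2 + z ^ 2) := fun x y z => by
      nlinarith [sq_nonneg (x - y), sq_nonneg (y - z), sq_nonneg (x - z)]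
    have h3' := h3 (f (c.2 - c.1) * T (c.1, c.2)) (f c.2 * T (-c.1, c.2 - c.1)) (f c.1 * T (c.2, c.2 - c.1))
    rw [hC0]
    nlinarith [h3', hX, hY, hZ]
  -- (4) only configurations off the hard core contribute
  have hvan : ∀ c : Cfg L, InD L c = true → C0fn L Δ lam2 f c = 0 := by
    intro c hc; unfold C0fn; rw [if_pos hc]
  set F' : Finset (Cfg L) := F.filter (fun c => InD L c = false) with hF'
  have hFF' : ∑ c ∈ F, C0fn L Δ lam2 f c ^ 2 = ∑ c ∈ F', C0fn L Δ lam2 f c ^ 2 := by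
    rw [hF']
    refine (Finset.sum_filter_of_ne fun c _ hne => ?_).symm
    by_contra hD
    have hD' : InD L c = true := by simpa using hD
    exact hne (by rw [hvan c hD']; ring)
  -- (5) membership facts on `F'`
  have hmemF' : ∀ c ∈ F', c.1 ≠ 0 ∧ c.2 ≠ 0 ∧ c.2 - c.1 ≠ 0 ∧
      IsNN L c.1 = false ∧ IsNN L c.2 = false ∧ IsNN L (c.2 - c.1) = false := by
    intro c hc
    rw [hF', Finset.mem_filter] at hc
    obtain ⟨hcF, hD⟩ := hc
    obtain ⟨hna, hnb, hnc⟩ := isNN_of_Wcount_zero L c (hF c hcF)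
    unfold InD at hD
    simp only [Bool.or_eq_false_iff, decide_eq_false_iff_not] at hD
    obtain ⟨⟨ha, hb⟩, hab⟩ := hD
    exact ⟨ha, hb, sub_ne_zero.mpr (fun h => hab h.symm), hna, hnb, hnc⟩
  -- (6) the three injections into `Reg × Reg`
  have hS1 : ∑ c ∈ F', T (c.1, c.2) ^ 2 ≤ ∑ p ∈ Reg ×ˢ Reg, T p ^ 2 := by
    have : ∑ c ∈ F', T (c.1, c.2) ^ 2 = ∑ c ∈ F', T c ^ 2 := Finset.sum_congr rfl fun c _ => rfl
    rw [this]
    apply Finset.sum_le_sum_of_subset_of_nonneg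
    · intro c hc
      obtain ⟨ha, hb, -, hna, hnb, -⟩ := hmemF' c hc
      exact Finset.mem_product.mpr ⟨hReg _ ha hna, hReg _ hb hnb⟩
    · intro p _ _; exact sq_nonneg _
  have hS2 : ∑ c ∈ F', T (-c.1, c.2 - c.1) ^ 2 ≤ ∑ p ∈ Reg ×ˢ Reg, T p ^ 2 := by
    have himg : ∑ p ∈ F'.image (fun c : Cfg L => ((-c.1, c.2 - c.1) : Cfg L)), T p ^ 2
        = ∑ c ∈ F', T (-c.1, c.2 - c.1) ^ 2 := by
      refine Finset.sum_image fun x _ y _ h => ?_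
      have h1 : x.1 = y.1 := neg_inj.mp (congrArg Prod.fst h)
      have h2 : x.2 - x.1 = y.2 - y.1 := congrArg Prod.snd h
      rw [h1, sub_left_inj] at h2
      exact Prod.ext h1 h2
    rw [← himg]
    apply Finset.sum_le_sum_of_subset_of_nonneg
    · intro p hp
      rw [Finset.mem_image] at hp
      obtain ⟨c, hc, rfl⟩ := hp
      obtain ⟨ha, -, hcc, hna, -, hnc⟩ := hmemF' c hc
      exact Finset.mem_product.mpr
        ⟨hReg _ (neg_ne_zero.mpr ha) (by rw [IsNN_neg]; exact hna), hReg _ hcc hnc⟩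
    · intro p _ _; exact sq_nonneg _
  have hS3 : ∑ c ∈ F', T (c.2, c.2 - c.1) ^ 2 ≤ ∑ p ∈ Reg ×ˢ Reg, T p ^ 2 := by
    have himg : ∑ p ∈ F'.image (fun c : Cfg L => ((c.2, c.2 - c.1) : Cfg L)), T p ^ 2
        = ∑ c ∈ F', T (c.2, c.2 - c.1) ^ 2 := by
      refine Finset.sum_image fun x _ y _ h => ?_
      have h1 : x.2 = y.2 := congrArg Prod.fst h
      have h2 : x.2 - x.1 = y.2 - y.1 := congrArg Prod.snd h
      rw [h1, sub_right_inj] at h2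
      exact Prod.ext h2 h1
    rw [← himg]
    apply Finset.sum_le_sum_of_subset_of_nonneg
    · intro p hp
      rw [Finset.mem_image] at hp
      obtain ⟨c, hc, rfl⟩ := hp
      obtain ⟨-, hb, hcc, -, hnb, hnc⟩ := hmemF' c hc
      exact Finset.mem_product.mpr ⟨hReg _ hb hnb, hReg _ hcc hnc⟩
    · intro p _ _; exact sq_nonneg _
  -- (7) assemble
  rw [hFF', hPsi]
  have hsum_pt := Finset.sum_le_sum hpt
  calc ∑ c ∈ F', C0fn L Δ lam2 f c ^ 2
      ≤ ∑ c ∈ F', 3 / 4 * M ^ 2 * (T (c.1, c.2) ^ 2 + T (-c.1, c.2 - c.1) ^ 2 + T (c.2, c.2 - c.1) ^ 2) :=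
        hsum_pt
    _ = 3 / 4 * M ^ 2 * (∑ c ∈ F', T (c.1, c.2) ^ 2 + ∑ c ∈ F', T (-c.1, c.2 - c.1) ^ 2
          + ∑ c ∈ F', T (c.2, c.2 - c.1) ^ 2) := by
      rw [← Finset.sum_add_distrib, ← Finset.sum_add_distrib, ← Finset.mul_sum]
    _ ≤ 3 / 4 * M ^ 2 * (3 * ∑ p ∈ Reg ×ˢ Reg, T p ^ 2) := by
      apply mul_le_mul_of_nonneg_left _ (by positivity)
      linarith [hS1, hS2, hS3]
    _ = 9 / 4 * M ^ 2 * ∑ p ∈ Reg ×ˢ Reg, T p ^ 2 := by ring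

/-! ## `C0FreeBound` -/

/-- ★ **`C0FreeBound L Δ` holds** (every `L`, every `Δ`): `‖C0‖²_{W=0} ≤ (9/4)·M²·Ψ`. [folklore] -/
theorem c0FreeBound_holds (Δ : ℝ) : C0FreeBound L Δ := by
  classical
  intro lam2 M f htm heven hM
  unfold nC0free PsiSum psiCorr
  simp only [nnList_sum_fin4]
  refine c0Free_core L htm heven hM _ (nnList_sum_fin4 L) (isNN_fin4 L) _ (fun c hc => ?_) _ (fun a ha hna => ?_)
  · exact (Finset.mem_filter.mp hc).2
  · exact Finset.mem_filter.mpr ⟨Finset.mem_univ _, ha, hna⟩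

end Summit.HubbardSuperconductivity.HubbardSuperconductivity.Theorems.AnisotropyChord.Transfer.Fibre3

end
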